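import Summits.Parity.GeneralizedHardyLittlewood.Theses.MaynardProductExact
import Literature.NumberTheory.Sieve.PolymathProductHoeffdingBounds
import HarnessLib

/-!
# BC3 birth skeleton — crux `DenUB3750` (rank 3) of route `MaynardProductExact`
(Parity / GeneralizedHardyLittlewood; item stmt-Parity-19251) — HOEFFDING-RECENTRED kernel-certificate form

Line-writer seat `linewriter-parity-certcluster-1` g0, 2026-08-31.  Supersedes the pre-open birth skeleton
`pub/parity-ideate/parity-ideate-p3/route4/bc/DenUB3750_birth.lean` (sha16 956f1c87e0283970, plain floor coupling with
a local crux `def`) and the v5 one-stub form `KernelCert_v5.lean` (62efce5af78542e6, plain lattice `h = 1/(8·10⁶)`):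
since then the tree has LANDED the Hoeffding-recentred lattice sandwich
`Literature.NumberTheory.Sieve.MaynardTao.setIntegral_cpow_le_hoeffding` (file `PolymathProductHoeffding`), the
explicit profile data `setIntegral_Ici_polymathProfile_sq`, `setIntegral_Ici_id_mul_polymathProfile_sq`,
`setIntegral_roundErr_mul_eq`, `cellMass_polymathProfile_sq` (files `PolymathProductHoeffdingBounds`,
`PolymathProductLatticeBounds`), the exact-integer soundness layer `ConvolutionPowerIntegerArithmetic` (Kronecker-packed
addition chains, directed rounding) and a COMPLETE kernel certificate of the same shape at `k = 4500`
(`MaynardProductKernelCert4500`: `eight_lt_maynardFunctional_4500`, four `decide +kernel` facts, ≈ 300 s, lattice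
`h = 1/200000` thanks to the recentring).  This line states the `k = 3750` DENOMINATOR obligation in exactly that shape.

LINE.  `DenUB3750` (`D = ∫_{(0,1]} (g²)^{⋆3750} ≤ 0.41694 · m₂^{3750}`, `g = polymathProfile 3750 (249/2000) (3/4)`,
`m₂ = ∫ g² = 10⁶/466771167` exactly)  ⇐  `stub_denHoeffdingCert`: on SOME lattice `h > 0` (cells `(jh,(j+1)h]`,
`J_c h > 3/4`), with a cutoff `m⋆` and a tail parameter `λ ≥ 0` satisfying the recentring side condition
`1 − (m⋆+1)h + λ ≤ 3750 · e` (`e` = mean rounding error of one factor = `(∫ r_h g²)/m₂`, made explicit by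
`roundErr_moment_eq` below: `∫ r_h g² = μ₁ − h Σ_{j<J_c} j p_j`, `μ₁ = (log(5623749/249) − 5623500/5623749)/3749²`),
the FINITE inequality `Σ_{m ≤ m⋆} (p^{∗3750})_m + m₂^{3750} e^{−2λ²/(3750 h²)} ≤ 0.41694 · m₂^{3750}` holds
(`p_j = cellMass g² h j`, exact rationals by `cellMass_polymathProfile_sq`).  Composition `DenUB3750_of` = one
application of `setIntegral_cpow_le_hoeffding` (PROVED below).  The stub is STRICTLY STRONGER than the crux (a specific
finite sufficient condition; certified numerically by the cell: `P(S_3750 ≤ 1) = 0.4165973…`, slack `3.4·10⁻⁴`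
absolute = `8·10⁻⁴` relative, kit j247320 / j249077) — not a restatement.  Size guide for the hand (writer's estimate,
not certified): density of `S` near `1` is ≈ `1.2 / m₂^k`-normalised, so the recentred threshold overshoot `≈ (Λ+1)h`
must be `≲ 3·10⁻⁴`, i.e. `h ≈ 1/(1–2.5·10⁶)` with `Λ = λ/h ≈ 350–500` cells (`e^{−2Λ²/3750} < 10⁻²⁸`): `2^21–2^22` packed
slots against `2^18` at `k = 4500` — split the `decide +kernel` facts as in the 4500 template (`FactC`, `sideOk`).
Alternative line (not registered): the plain lattice form of `KernelCert_v5.lean`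
(`∃ q ≥ cellMass, Σ_{m ≤ 8·10⁶} (q^{∗3750})_m ≤ bound` at `h = 1/(8·10⁶)`, via `setIntegral_cpow_le_sum_dconvPow`).
Proof class: ccert / kernel (`decide +kernel`); the LINE is kit 0.
-/

noncomputable section

open MeasureTheory Set Finset
open Literature.Analysis.Convolution Literature.NumberTheory.Sieve Literature.NumberTheory.Sieve.MaynardTao

namespace Summit.Parity.GeneralizedHardyLittlewood.Cruxes.DenUB3750.Birth

/-- Polymath's profile `g = 1_{[0,3/4]}/(249/2000 + 3749 t)` and the one-factor density `φ = g²` (`k = 3750`). -/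
def g : ℝ → ℝ := polymathProfile 3750 ((249 : ℝ) / 2000) ((3 : ℝ) / 4)
/-- `φ = g²`. -/
def φ : ℝ → ℝ := fun t => polymathProfile 3750 ((249 : ℝ) / 2000) ((3 : ℝ) / 4) t ^ 2

theorem g_locBdd : LocBdd g := locBdd_polymathProfile (k := 3750) (by norm_num) (by norm_num) (by norm_num)

theorem g_nonneg : ∀ t, 0 ≤ g t := by
  intro t
  by_cases ht : t ∈ Icc (0:ℝ) ((3 : ℝ) / 4)
  · have h1 := (polymathProfile_mem_Icc (k := 3750) (by norm_num) (by norm_num : (0:ℝ) < 249 / 2000)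
      (by norm_num) ht).1
    refine le_trans (one_div_pos.2 ?_).le h1
    have := ht.2; push_cast; nlinarith [ht.1, ht.2]
  · simp [g, polymathProfile_of_notMem ht]

theorem g_eq_zero_of_gt : ∀ x, (3 : ℝ) / 4 < x → g x = 0 :=
  fun x hx => polymathProfile_of_notMem fun h' => (not_lt.2 h'.2) hx

theorem φ_locBdd : LocBdd φ := by
  have : φ = fun t => g t * g t := by funext t; simp [φ, g, sq]
  rw [this]; exact g_locBdd.mul g_locBdd

theorem φ_nonneg : ∀ t, 0 ≤ φ t := fun t => sq_nonneg _

theorem φ_eq_zero_of_gt : ∀ x, (3 : ℝ) / 4 < x → φ x = 0 := fun x hx => by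
  simp only [φ]; rw [show polymathProfile 3750 ((249 : ℝ) / 2000) ((3 : ℝ) / 4) x = g x from rfl,
    g_eq_zero_of_gt x hx]; ring

/-- `m₂ = ∫_{[0,∞)} g² = T/(c(c+(k−1)T)) = 10⁶/466771167` EXACTLY (PROVED, `setIntegral_Ici_polymathProfile_sq`). -/
theorem mass_eq : (1000000 : ℝ) / 466771167 = ∫ x in Ici 0, φ x := by
  simp only [φ]
  rw [setIntegral_Ici_polymathProfile_sq (k := 3750) (by norm_num) (by norm_num) (by norm_num)]
  norm_num

/-- **The mean rounding error of one factor, explicit** (PROVED; `setIntegral_roundErr_mul_eq` +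
`setIntegral_Ici_id_mul_polymathProfile_sq`): for a lattice `h > 0` with `J_c h > 3/4`,
`∫_{[0,∞)} r_h φ = (log(5623749/249) − 5623500/5623749)/3749² − h Σ_{j<J_c} j p_j`. -/
theorem roundErr_moment_eq {h : ℝ} (hh : 0 < h) {Jc : ℕ} (hJc : (3 : ℝ) / 4 < (Jc : ℝ) * h) :
    ∫ x in Ici 0, roundErr h x * φ x =
      1 / (3749 : ℝ) ^ 2 * (Real.log ((5623749 : ℝ) / 249) - (5623500 : ℝ) / 5623749) -
        h * ∑ j ∈ range Jc, (j : ℝ) * cellMass φ h j := by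
  rw [setIntegral_roundErr_mul_eq φ_locBdd φ_eq_zero_of_gt hh hJc]
  simp only [φ]
  rw [setIntegral_Ici_id_mul_polymathProfile_sq (k := 3750) (by norm_num) (by norm_num) (by norm_num)]
  norm_num

/-- Stub statement (the Hoeffding-recentred DENOMINATOR lattice certificate), `φ` unfolded. -/
def Signature.stub_denHoeffdingCert : Prop :=
  ∃ (h : ℝ) (Jc mstar : ℕ) (lam : ℝ), 0 < h ∧ (3 : ℝ) / 4 < (Jc : ℝ) * h ∧ 0 ≤ lam ∧
    (1 - ((mstar : ℝ) + 1) * h) + lam ≤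
      (3750 : ℝ) * ((∫ x in Ici 0, roundErr h x * polymathProfile 3750 ((249 : ℝ) / 2000) ((3 : ℝ) / 4) x ^ 2) /
        ((1000000 : ℝ) / 466771167)) ∧
    ∑ m ∈ range (mstar + 1),
        dconvPow (cellMass (fun t => polymathProfile 3750 ((249 : ℝ) / 2000) ((3 : ℝ) / 4) t ^ 2) h) 3750 m +
      ((1000000 : ℝ) / 466771167) ^ 3750 * Real.exp (-2 * lam ^ 2 / ((3750 : ℝ) * h ^ 2)) ≤
      (41694 : ℝ) / 100000 * ((1000000 : ℝ) / 466771167) ^ 3750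

/-- **The open stub** (XL, kernel-certificate class): statement SPELLED OUT (definitionally
`Signature.stub_denHoeffdingCert`, see the `example` below).  Some lattice `h > 0`, `J_c h > 3/4`, a cutoff `m⋆`
and `λ ≥ 0` with the recentring side condition `1 − (m⋆+1)h + λ ≤ 3750·(∫ r_h g²)/m₂` and
`Σ_{m ≤ m⋆} (p^{∗3750})_m + m₂^{3750} e^{−2λ²/(3750 h²)} ≤ 0.41694 · m₂^{3750}`, `p = cellMass g² h`, `m₂ = 10⁶/466771167`. -/
theorem stub_denHoeffdingCert :
    ∃ (h : ℝ) (Jc mstar : ℕ) (lam : ℝ), 0 < h ∧ (3 : ℝ) / 4 < (Jc : ℝ) * h ∧ 0 ≤ lam ∧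
      (1 - ((mstar : ℝ) + 1) * h) + lam ≤
        (3750 : ℝ) * ((∫ x in Ici 0, roundErr h x * polymathProfile 3750 ((249 : ℝ) / 2000) ((3 : ℝ) / 4) x ^ 2) /
          ((1000000 : ℝ) / 466771167)) ∧
      ∑ m ∈ range (mstar + 1),
          dconvPow (cellMass (fun t => polymathProfile 3750 ((249 : ℝ) / 2000) ((3 : ℝ) / 4) t ^ 2) h) 3750 m +
        ((1000000 : ℝ) / 466771167) ^ 3750 * Real.exp (-2 * lam ^ 2 / ((3750 : ℝ) * h ^ 2)) ≤
        (41694 : ℝ) / 100000 * ((1000000 : ℝ) / 466771167) ^ 3750 := by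
  sorry

example : Signature.stub_denHoeffdingCert := stub_denHoeffdingCert

/-- **Composition (kernel-checked)**: the stub gives the ROUTE crux BY NAME, through the landed Hoeffding-recentred
lattice sandwich `setIntegral_cpow_le_hoeffding`. -/
theorem DenUB3750_of :
    Signature.stub_denHoeffdingCert →
      Summit.Parity.GeneralizedHardyLittlewood.Theses.MaynardProductExact.DenUB3750 := by
  rintro ⟨h, Jc, mstar, lam, hh, hJc, hlam, hcond, hsum⟩
  have hm₀pos : (0 : ℝ) < (1000000 : ℝ) / 466771167 := by norm_num
  have hcond' : (1 - ((mstar : ℝ) + 1) * h) + lam ≤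
      ((3749 : ℕ) + 1 : ℝ) * ((∫ x in Ici 0, roundErr h x * φ x) / ((1000000 : ℝ) / 466771167)) := by
    have e : ((3749 : ℕ) + 1 : ℝ) = (3750 : ℝ) := by norm_num
    rw [e]; exact hcond
  have main := setIntegral_cpow_le_hoeffding φ_locBdd φ_nonneg φ_eq_zero_of_gt hh hJc 3749 mstar hlam mass_eq
    hm₀pos hcond'
  have e1 : (3749 + 1 : ℕ) = 3750 := rfl
  have e2 : ((3749 : ℕ) + 1 : ℝ) = (3750 : ℝ) := by norm_num
  rw [e1, e2] at main
  exact main.trans hsum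

/-- **The skeleton instantiated**: the crux BY NAME modulo the single registered stub (carries exactly its `sorry`). -/
theorem DenUB3750_of_stubs :
    Summit.Parity.GeneralizedHardyLittlewood.Theses.MaynardProductExact.DenUB3750 :=
  DenUB3750_of stub_denHoeffdingCert

end Summit.Parity.GeneralizedHardyLittlewood.Cruxes.DenUB3750.Birth

end
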